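import Literature.MathematicalPhysics.QuantumFieldTheory.Balaban1983to89.B5Hk163Decay

/-!
# `Balaban1983to89.B6Hprime2101` — the momentum multipliers of `H′_j` (2.101) and `Δ′_j` (2.107)–(2.109) of [B6] on a `d`-only complex strip, and the exponential decay of their lattice / torus kernels (cell node B6-HPRIME-2101, census rows p. 241 BA G-B6-06, (2.107)–(2.109) p. 242)

T. Bałaban, *Propagators and renormalization transformations for lattice gauge theories. II*, Commun. Math.
Phys. **96**, 223–250 (1984) [`Balaban1984PropagatorsII`, cell paper B6].  PRINTED TEXT (LOCATIONS only; the
renders `…1984-cmp96-propagators-rt-II-p019-x2.png` (p. 241) and `…-p020-x2.png` (p. 242) were read AS IMAGES by the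
author of this file):

* p. 241 [PDF 19], (2.101)–(2.102) and the sentence certified here, verbatim: «We may assume also that λ is orthogonal
  to constant functions because a constant component of λ does not influence the gauge transformation defined by ∂λ,
  hence  λ = Δ⁻²Q′_j*(Q′_jΔ⁻²Q′_j*)⁻¹μ,  μ = Q′_jλ. (2.101) … It is easy to see that it defines an operator which is
  connected with the integral  Z′_j⁻¹ ∫dλ′ δ(Q′_jλ′ − μ) e^{−½‖Δλ′‖²} (2.102) in the same way as the operator H_k was
  connected with the integral (1.47). It gives a solution of the variational problem inf_{λ′ : Q′_jλ′ = μ} ½‖Δλ′‖².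
  Let us denote the operator in (2.101) by H′_j, so λ = H′_jμ. From the momentum representation of (2.101) we may get
  easily that H′_j is a bounded operator with an exponential decay, the bound and decay rate depending on d only.»
  and, same page, «where the equality Q′_jλ = Q′_jH′_jμ = μ was used.»
* p. 242 [PDF 20], (2.107)–(2.109), verbatim: «and the operator Δ′_j was defined by the second equality,
  Δ′_j = H′_j*Δ²H′_j. (2.107) In momentum representation on the unit lattice the operator Δ′_j is represented as the
  multiplication operator by the function  Δ′_j(p′) = Δ₀²(p′)(Σ_l |u_j(p′+l)|²Δ₀²(p′)/Δ²(p′+l))⁻¹. (2.108) From this we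
  get an exponential decay of Δ′_j(y − y′) and the bound  c₀‖Δ₀ω‖² ≦ ⟨ω, Δ′_jω⟩ ≦ c₁‖Δ₀ω‖² ≦ γ₁‖ω‖². (2.109)»
* the METHOD, printed in paper I of the series (T. Bałaban, CMP **95** (1984) 17–40 [`Balaban1984PropagatorsI`], p. 38
  [PDF 22]), verbatim: «They follow from the representation P = G′Q′*(Q′G′²Q′*)⁻¹Q′G′, from Lemma 2.4 of [2], and the
  representation (1.45) and the analyticity method of proving an exponential decay (see the proof of Lemma 2.4 in
  [2]).»; and the same scalar operator printed in paper I, p. 24 (1.38): «R = I − Δ⁻¹Q′_k*(Q′_kΔ⁻²Q′_k*)⁻¹Q′_kΔ⁻¹»,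
  p. 28 (1.60): «… + [∂Δ⁻²Q′_k*(Q′_kΔ⁻²Q′_k*)⁻¹ − …]».

WHAT [B6] DOES NOT PRINT: the momentum representation of (2.101) itself, the strip, the constants and the decay rate
behind «the bound and decay rate depending on d only», and the constants `c₀, c₁, γ₁` of (2.109).  In the tree this is
the LOCATED RESIDUAL (c) of GAPS G-B6-05a named in `…Balaban1983to89.B6FromB4` («the j-uniform analyticity strip behind
the decay of Δ′_j (2.108) and of H′_j (2.132): untouched») and the hypothesis shape `…B6Elimination.KernelDecay` at
step (S2).  ABSOLUTE RULE of the cell: nothing printed enters as a hypothesis; every `[cite: …]` tag below is a TEXT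
LOCATION; every statement is PROVED here (`[folklore]`: our construction in the style of the p. 38 method), 0 sorry.

## Dictionary (ours; `ξ = L^{−j} = 1/n`, unit blocks, all of paper I's b05-cell symbols at `m² = 0`)

`Δ(p′+l) = B4Strip.DeltaXi n 0 (shift n k p′)` (`l = 2πk`, `k ∈ {0,…,n−1}^d`; the FINE Laplacian — [B6]'s `Δ`),
`Δ₀(p′) = B4Strip.Delta1 0 p′` ([B6]'s UNIT-lattice Laplacian `Δ₀`), `|u_j(p′+l)|² = B4Strip.U n k p′`,
`ū_j(p′+l)` continued `= B5Hk163Strip.uCbar n k p′`, `ρ_l = Δ(p′)/Δ(p′+l) = B5Hk163Strip.rho`,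
`𝒩(p′) = |u(p′)|² + Δ(p′)²·Σ_{l≠0}|u(p′+l)|²/Δ²(p′+l) = B5Strip145.Ncal` (zero-free on `Strip d κ`, `κ ≤ κ_N(d)`:
`B5Hk163Strip.Ncal_lower`), `Σ_l |u(p′+l)|²/Δ²(p′+l) = B5Strip145Analytic.Yfac` — so that the bracket of (2.108) is
LITERALLY the first sum of paper I's (1.45) (`B5Strip145.m145`).  KEY OBSERVATION: in momentum space (2.101) reads,
alias by alias, `λ̃(p′+l) = ū(p′+l)Δ(p′+l)⁻² · (Σ_{l″}|u(p′+l″)|²Δ(p′+l″)⁻²)⁻¹ · μ̃(p′)` (`hPrinted`), whose `l = 0`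
factor `Δ(p′)⁻²` and whose bracket both blow up at `p′ = 0` and on the complex zero-cone of `Δ(p′)`
(`B4Strip.printed_factor_has_poles`); multiplying numerator and denominator by `Δ(p′)²` gives the REGROUPED form
`h′_l(p′) = ū(p′+l)·ρ_l(p′)²/𝒩(p′)` (`hP`) whose only denominators are `𝒩` and the shifted `Δ(p′+l)`, `l ≠ 0` — all
zero-free on the strip — and likewise `Δ′_j(p′) = Δ(p′)²/𝒩(p′)` (`dP`) for (2.108).

## Content (sorry-free)

* §1 `hP`, `dP`, the literal printed forms `hPrinted` / `dPrinted` and the identifications off `Δ(p′) = 0`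
  (`hP_eq_printed`, `dP_eq_printed`, `dP_eq_inv_Yfac` — (2.107) `= (Q′Δ⁻²Q′*)⁻¹`); the symbol identities behind
  «Q′_jH′_jμ = μ» (`sum_U_mul_rho_sq`, `sum_U_mul_rho_sq_div`; real form `sum_uSym_mul_hP` with paper I's `uSym`) and
  behind (2.107) `H′*Δ²H′ = Δ′` (`symbol_2107`); the values at `p′ = 0` (`hP_zero_*`, `dP_zero`).
* §2 on `Strip d κ`, `0 ≤ κ ≤ κ_N(d)` (`B5Hk163Strip.kappaN`, depends on `d` only), for EVERY `n ≥ 1` and every alias: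
  `𝒩 ≠ 0`; the PRODUCT-DECAYING bound `‖h′_l‖ ≤ c_H(d)·Π_ν (12/ω_n(l_ν))ω_n(l_ν)^{−2/d}` (`norm_hP_le_decay`, from
  `B5Hk163Alias.norm_uCbar_le_prod` / `norm_rho_le_prod`) and the `n`-UNIFORM alias sum `Σ_l ‖h′_l(p′)‖ ≤ S_H(d)`
  (`sum_norm_hP_le`, `B5Hk163Alias.sum_prod_decay_le`), hence `Σ_l ‖h′_l‖² ≤ S_H(d)²` (`sum_normSq_hP_le`,
  `sum_normSq_hP_le_real`: the symbol of `H′*H′`, i.e. «H′_j is a bounded operator» at symbol level, every real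
  momentum); `‖Δ′(p′)‖ ≤ M_Δ′(d)` (`norm_dP_le`); holomorphy;
  and the ALIAS RE-INDEXING COVARIANCE across the strip sides `h′_l(p′+2πe_ν) = h′_{σ_ν l}(p′)`, `Δ′(p′+2πe_ν) = Δ′(p′)`
  (`hP_tr`, `dP_tr`; from `B5Hk163Alias.uCbar_tr` / `rho_tr_mul`, `B5Strip145Analytic.Ncal_tr`).
* §3 the fine-offset multipliers `G′_a(p′) = Σ_l e^{i(p′+l)·ηa} h′_l(p′)` (`GH`, phase `B5Hk163Decay.phase163` BY
  NAME), `stripRegular_GH` and `stripRegular_dP` (`B4ContourShift.StripRegular`, dimension `d+1`, constants `d`-only,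
  every `n ≥ 1`, every fine offset `a`), and BY NAME of the b04 engine: `latticeKernel_GH_decay`,
  `torusKernel_GH_decay` («H′_j … with an exponential decay, the bound and decay rate depending on d only»),
  `latticeKernel_dP_decay`, `torusKernel_dP_decay` («an exponential decay of Δ′_j(y − y′)»), and the ENTRYWISE forms
  `kernelDecay_GH` and `kernelDecay_dP` — `|Re K(y − y′)| ≤ M_Δ′ e^{−κ_N·dist(y,y′)}` on `ℤ^{d+1}`, i.e.
  `B6Elimination.KernelDecay Λ Δ M_Δ′ κ_N` for the matrix `Δ p q := Re K(p − q)` of every region `Λ` (that module is not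
  imported; the shape is identical).
* §4 the real-momentum content of (2.109): with the tree's comparisons `Δ₀ ≤ Δ ≤ (π²/4)Δ₀` on the Brillouin zone
  (`B5Prop11Leaves.Delta1r_le_DeltaXir` / `DeltaXir_le_Delta1r`, BY NAME), the real symbol `dPr = Δ²/𝒩` (`dP_ofReal`) and
  `c₀(d)·Δ₀(s)² ≤ Δ′(s) ≤ c₁(d)·Δ₀(s)² ≤ γ₁(d)` for every `s ∈ [−π,π]^d`, every `n ≥ 1` (`bound_2109`; inputs
  `B5Strip145.Ncalr_ge`, `B5Strip145Leaves.norm_Ncal_le`).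

## Honest scope

(i) The Plancherel / Fourier-inversion bookkeeping identifying `latticeKernel (GH n a) (y′ − y)` with «the kernel of
`H′_j` from the unit point `y` to the fine point `y′ + ηa`» and `⟨ω, Δ′_jω⟩ = ∫|ω̃|²Δ′_j` for TYPED operators on
`ℓ²(T_ξ)`, `ℓ²(T₁)` is left to the consumer, exactly as in `B5Hk163Decay` (its §4 `exp_fine_phase_split` is the
dictionary); the restriction «μ orthogonal to constant functions» is the exclusion of `p′ = 0`, where our regrouped
symbols take the limiting values `h′_0(0) = 1`, `h′_l(0) = 0` (`l ≠ 0`), `Δ′(0) = 0` (§1).  (ii) (2.110)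
(`γ₀ = γ₀(d, L)`, the block Poincaré inequality) and the covariance `C′^{(j)}_Λ` are NOT touched (tree:
`B6Elimination`, `B6FromB4`).  (iii) The variational characterisation (2.102) is not re-typed (finite-dimensional
algebra; cf. `B5Hk103Minimizer` for paper I's `H_k`).  (iv) Constants (`cHP`, `SHP`, `MdP`, `κ_N`, `c0_2109`, `c1_2109`,
`gamma1_2109`) are crude, ours, `d`-only — never Bałaban's; `n ≥ 1` arbitrary (not only `n = L^j`).  Value = kernel
certificate of a located, asserted step; NOT summit progress, NOT continuum, NOT Clay.
-/

open scoped BigOperators Real ComplexConjugate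
open Finset Complex

namespace Literature.MathematicalPhysics.QuantumFieldTheory.Balaban1983to89.B6Hprime2101

open Literature.MathematicalPhysics.QuantumFieldTheory.Balaban1983to89.B4Strip
open Literature.MathematicalPhysics.QuantumFieldTheory.Balaban1983to89.B4StripCauchy
open Literature.MathematicalPhysics.QuantumFieldTheory.Balaban1983to89.B4StripSums (omega omega_pos zetaC
  zetaC_nonneg CR CR_nonneg tr_mem_Strip)
open Literature.MathematicalPhysics.QuantumFieldTheory.Balaban1983to89.B4ContourShift
open Literature.MathematicalPhysics.QuantumFieldTheory.Balaban1983to89.B4TorusKernel (descendC periodConst)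
open Literature.MathematicalPhysics.QuantumFieldTheory.Balaban1983to89.B4TorusKernel.MultiPeriod (torusKernel
  torusSupNorm torusKernel_descend_decay_torusMetric)
open Literature.MathematicalPhysics.QuantumFieldTheory.Balaban1983to89.B5Strip145 (Ncal Ncalr Xne Xner Ncal_ofReal
  Ncalr_ge Ncal_re_ge sum_num_factor)
open Literature.MathematicalPhysics.QuantumFieldTheory.Balaban1983to89.B5Strip145Leaves (boundN boundN_pos
  norm_Ncal_le)
open Literature.MathematicalPhysics.QuantumFieldTheory.Balaban1983to89.B5Strip145Analytic
open Literature.MathematicalPhysics.QuantumFieldTheory.Balaban1983to89.B5Strip145Decay (differentiableAt_insertNth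
  tr_insertNth_left insertNth_left_mem)
open Literature.MathematicalPhysics.QuantumFieldTheory.Balaban1983to89.B5Symbol166Strip (norm_DeltaXi0_le
  edge_conditions)
open Literature.MathematicalPhysics.QuantumFieldTheory.Balaban1983to89.B5Prop11Fiber (uSym)
open Literature.MathematicalPhysics.QuantumFieldTheory.Balaban1983to89.B5Prop11Leaves (Delta1r_le_DeltaXir
  DeltaXir_le_Delta1r Delta1r_le)
open Literature.MathematicalPhysics.QuantumFieldTheory.Balaban1983to89.B5Hk163Strip
open Literature.MathematicalPhysics.QuantumFieldTheory.Balaban1983to89.B5Hk163Alias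
open Literature.MathematicalPhysics.QuantumFieldTheory.Balaban1983to89.B5Hk163Decay (phase163 norm_phase163_le
  differentiable_phase163 phase163_tr)

noncomputable section

variable {d : ℕ}

/-! ## §1. The regrouped multipliers of `H′_j` and `Δ′_j`, the printed forms, the symbol identities -/

section Defs

variable (n : ℕ) [NeZero n]

/-- **THE REGROUPED (2.101) MULTIPLIER** `h′_l(p′) := ū(p′+l)·ρ_l(p′)²/𝒩(p′)` — the coefficient of `μ̃(p′)` in
`(H′_jμ)~(p′+l)`, continued to complex `p′`; denominators `𝒩` and (inside `ρ_l`) `Δ(p′+l)`, `l ≠ 0`, only.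
[cite: Balaban1984PropagatorsII, (2.101) p.241 (text of the formula only; momentum form and regrouping ours)] [folklore] -/
def hP (k : Fin d → Fin n) (p : Fin d → ℂ) : ℂ :=
  uCbar n k p * rho n k p ^ 2 / Ncal n p

/-- **THE REGROUPED (2.108)** `Δ′_j(p′) := Δ(p′)²/𝒩(p′)`, continued to complex `p′`.
[cite: Balaban1984PropagatorsII, (2.108) p.242 (text of the formula only; regrouping ours)] [folklore] -/
def dP (p : Fin d → ℂ) : ℂ :=
  DeltaXi n 0 p ^ 2 / Ncal n p

/-- the PRINTED (2.101) in momentum space, alias by alias: `ū(p′+l)Δ(p′+l)⁻² · (Σ_{l″}|u(p′+l″)|²Δ(p′+l″)⁻²)⁻¹`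
(`Δ⁻²Q′*` after `(Q′Δ⁻²Q′*)⁻¹`; the sum is `B5Strip145Analytic.Yfac`).
[cite: Balaban1984PropagatorsII, (2.101) p.241 (text of the formula only)] [folklore] -/
def hPrinted (k : Fin d → Fin n) (p : Fin d → ℂ) : ℂ :=
  uCbar n k p / DeltaXi n 0 (shift n k p) ^ 2 * (Yfac n p)⁻¹

/-- the PRINTED (2.108), transcribed literally: `Δ′_j(p′) = Δ₀²(p′)(Σ_l |u_j(p′+l)|²Δ₀²(p′)/Δ²(p′+l))⁻¹`
(`Δ₀ = Delta1 0`, `Δ(p′+l) = DeltaXi n 0 ∘ shift`, `|u_j(p′+l)|² = U`).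
[cite: Balaban1984PropagatorsII, (2.108) p.242 (text of the formula only)] [folklore] -/
def dPrinted (p : Fin d → ℂ) : ℂ :=
  Delta1 0 p ^ 2 * (∑ k : Fin d → Fin n, U n k p * Delta1 0 p ^ 2 / DeltaXi n 0 (shift n k p) ^ 2)⁻¹

end Defs

section Identities

variable (n : ℕ) [NeZero n]

/-- `Σ_l |u(p′+l)|² ρ_l(p′)² = 𝒩(p′)` identically (the definition of the regrouped numerator, alias by alias).
[folklore] -/
theorem sum_U_mul_rho_sq (p : Fin d → ℂ) : ∑ k : Fin d → Fin n, U n k p * rho n k p ^ 2 = Ncal n p := by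
  rw [← Finset.add_sum_erase _ _ (Finset.mem_univ (fun _ => (0 : Fin n)))]
  unfold Ncal Xne
  have h0 : rho n (fun _ => (0 : Fin n)) p = 1 := by unfold rho; rw [if_pos rfl]
  rw [h0, one_pow, mul_one, Finset.mul_sum]
  congr 1
  refine Finset.sum_congr rfl (fun k hk => ?_)
  have hk' : k ≠ fun _ => 0 := Finset.ne_of_mem_erase hk
  unfold rho
  rw [if_neg hk']
  ring

/-- «Q′_jλ = Q′_jH′_jμ = μ» at symbol level: `Σ_l |u(p′+l)|²·(ρ_l²/𝒩) = 1` wherever `𝒩(p′) ≠ 0` (in particular on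
the whole strip of §2 and at every real momentum). [cite: Balaban1984PropagatorsII, p.241 (the sentence after (2.103))] [folklore] -/
theorem sum_U_mul_rho_sq_div (p : Fin d → ℂ) (hN : Ncal n p ≠ 0) :
    ∑ k : Fin d → Fin n, U n k p * (rho n k p ^ 2 / Ncal n p) = 1 := by
  have h : ∑ k : Fin d → Fin n, U n k p * (rho n k p ^ 2 / Ncal n p)
      = (∑ k : Fin d → Fin n, U n k p * rho n k p ^ 2) / Ncal n p := by
    rw [Finset.sum_div]
    exact Finset.sum_congr rfl (fun k _ => by ring)
  rw [h, sum_U_mul_rho_sq, div_self hN]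

/-- the REAL form of «Q′_jH′_jμ = μ»: on the Brillouin zone, with paper I's block-averaging symbol `u(p′+l) = uSym`,
`Σ_l u(p′+l)·h′_l(p′) = 1` for every `n ≥ 1` (`ū` continued IS `conj u` there: `B5Hk163Strip.uCbar_ofReal`).
[cite: Balaban1984PropagatorsII, p.241] [folklore] -/
theorem sum_uSym_mul_hP (s : Fin d → ℝ) (hs : ∀ μ, |s μ| ≤ Real.pi) :
    ∑ k : Fin d → Fin n, uSym n k s * hP n k (ofRealVec s) = 1 := by
  have hn : 1 ≤ n := Nat.one_le_iff_ne_zero.mpr (NeZero.ne n)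
  have hN : Ncal n (ofRealVec s) ≠ 0 := by
    intro h
    have := Ncal_re_ge n hn s hs
    rw [h, norm_zero] at this
    have : (0 : ℝ) < (4 / Real.pi ^ 2) ^ d := by positivity
    linarith
  have hterm : ∀ k : Fin d → Fin n, uSym n k s * hP n k (ofRealVec s)
      = U n k (ofRealVec s) * (rho n k (ofRealVec s) ^ 2 / Ncal n (ofRealVec s)) := by
    intro k
    unfold hP
    rw [uCbar_ofReal, U_ofReal_normSq n hn k s hs, ← Complex.mul_conj]
    ring
  simp_rw [hterm]
  exact sum_U_mul_rho_sq_div n _ hN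

/-- **(2.107) AT SYMBOL LEVEL**: `Σ_l |u(p′+l)|²·Δ(p′+l)²·(ρ_l²/𝒩)² = Δ(p′)²/𝒩` identically — the momentum symbol of
`H′*Δ²H′` (`|h′_l|² = |u(p′+l)|²(ρ_l²/𝒩)²` at real momenta) IS (2.108) regrouped.
[cite: Balaban1984PropagatorsII, (2.107)–(2.108) p.242] [folklore] -/
theorem symbol_2107 (p : Fin d → ℂ) :
    ∑ k : Fin d → Fin n, U n k p * DeltaXi n 0 (shift n k p) ^ 2 * (rho n k p ^ 2 / Ncal n p) ^ 2 = dP n p := by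
  have key : ∑ k : Fin d → Fin n, U n k p * DeltaXi n 0 (shift n k p) ^ 2 * rho n k p ^ 4
      = DeltaXi n 0 p ^ 2 * Ncal n p := by
    rw [← Finset.add_sum_erase _ _ (Finset.mem_univ (fun _ => (0 : Fin n)))]
    unfold Ncal Xne
    have h0 : rho n (fun _ => (0 : Fin n)) p = 1 := by unfold rho; rw [if_pos rfl]
    rw [h0, shift_zero, one_pow, mul_one, mul_add, Finset.mul_sum, Finset.mul_sum]
    congr 1
    · ring
    · refine Finset.sum_congr rfl (fun k hk => ?_)
      have hk' : k ≠ fun _ => 0 := Finset.ne_of_mem_erase hk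
      unfold rho
      rw [if_neg hk']
      by_cases hD : DeltaXi n 0 (shift n k p) = 0
      · simp [hD]
      · field_simp
  have h : ∑ k : Fin d → Fin n, U n k p * DeltaXi n 0 (shift n k p) ^ 2 * (rho n k p ^ 2 / Ncal n p) ^ 2
      = (∑ k : Fin d → Fin n, U n k p * DeltaXi n 0 (shift n k p) ^ 2 * rho n k p ^ 4) / Ncal n p ^ 2 := by
    rw [Finset.sum_div]
    exact Finset.sum_congr rfl (fun k _ => by ring)
  rw [h, key]
  unfold dP
  by_cases hN : Ncal n p = 0
  · simp [hN]
  · field_simp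

/-- IDENTIFICATION WITH THE PRINTED (2.101): off the zero set of `Δ(p′)` — in particular at every real `p′ ≠ 0` —
the regrouped multiplier IS the printed one. [cite: Balaban1984PropagatorsII, (2.101) p.241] [folklore] -/
theorem hP_eq_printed {p : Fin d → ℂ} (h0 : DeltaXi n 0 p ≠ 0) (k : Fin d → Fin n) :
    hP n k p = hPrinted n k p := by
  unfold hP hPrinted
  rw [rho_eq_div n h0 k, Ncal_eq_DeltaXi_sq_mul_Yfac n p h0]
  by_cases hD : DeltaXi n 0 (shift n k p) = 0
  · simp [hD]
  · by_cases hY : Yfac n p = 0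
    · simp [hY]
    · field_simp

/-- **(2.107) `Δ′_j = (Q′_jΔ⁻²Q′_j*)⁻¹`** at symbol level: off the zero set of `Δ(p′)`, `Δ′(p′) = (Σ_l |u(p′+l)|²/Δ²(p′+l))⁻¹`.
[cite: Balaban1984PropagatorsII, (2.107) p.242] [folklore] -/
theorem dP_eq_inv_Yfac {p : Fin d → ℂ} (h0 : DeltaXi n 0 p ≠ 0) : dP n p = (Yfac n p)⁻¹ := by
  unfold dP
  rw [Ncal_eq_DeltaXi_sq_mul_Yfac n p h0]
  by_cases hY : Yfac n p = 0
  · simp [hY]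
  · field_simp

/-- IDENTIFICATION WITH THE PRINTED (2.108): off the zero sets of `Δ(p′)` and `Δ₀(p′)` — in particular at every real
`p′ ≠ 0` — the regrouped symbol IS the printed one. [cite: Balaban1984PropagatorsII, (2.108) p.242] [folklore] -/
theorem dP_eq_printed {p : Fin d → ℂ} (h0 : DeltaXi n 0 p ≠ 0) (h1 : Delta1 0 p ≠ 0) :
    dP n p = dPrinted n p := by
  rw [dP_eq_inv_Yfac n h0]
  unfold dPrinted
  rw [sum_num_factor]
  unfold Yfac
  by_cases hY : (∑ k : Fin d → Fin n, U n k p / DeltaXi n 0 (shift n k p) ^ 2) = 0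
  · simp [hY]
  · field_simp

/-- at `p′ = 0` (the constant mode, excluded in [B6] by «μ orthogonal to constant functions») the regrouped symbols take
the limiting values: `𝒩(0) = 1`. [folklore] -/
theorem Ncal_zero : Ncal n (fun _ : Fin d => (0 : ℂ)) = 1 := by
  have hD : DeltaXi n 0 (fun _ : Fin d => (0 : ℂ)) = 0 := by simp [DeltaXi, Sxi]
  have hU : U n (fun _ => (0 : Fin n)) (fun _ : Fin d => (0 : ℂ)) = 1 := by
    unfold U uFactor
    simp
  unfold Ncal
  rw [hD, hU]
  simp

/-- `Δ′(0) = 0`. [folklore] -/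
theorem dP_zero : dP n (fun _ : Fin d => (0 : ℂ)) = 0 := by
  have hD : DeltaXi n 0 (fun _ : Fin d => (0 : ℂ)) = 0 := by simp [DeltaXi, Sxi]
  unfold dP
  rw [hD]
  simp

/-- `h′_l(0) = 0` for `l ≠ 0`. [folklore] -/
theorem hP_zero_of_ne (k : Fin d → Fin n) (hk : k ≠ fun _ => 0) : hP n k (fun _ : Fin d => (0 : ℂ)) = 0 := by
  have hD : DeltaXi n 0 (fun _ : Fin d => (0 : ℂ)) = 0 := by simp [DeltaXi, Sxi]
  unfold hP rho
  rw [if_neg hk, hD]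
  simp

/-- `h′_0(0) = 1` (`H′_j` maps the constant `μ ≡ 1` to the constant `λ ≡ 1`). [folklore] -/
theorem hP_zero_zero : hP n (fun _ => (0 : Fin n)) (fun _ : Fin d => (0 : ℂ)) = 1 := by
  have hU : uCbar n (fun _ => (0 : Fin n)) (fun _ : Fin d => (0 : ℂ)) = 1 := by
    unfold uCbar vCbar
    have hn : (n : ℂ) ≠ 0 := Nat.cast_ne_zero.mpr (NeZero.ne n)
    simp [shift, hn]
  unfold hP rho
  rw [if_pos rfl, Ncal_zero, hU]
  simp

end Identities

/-! ## §2. The zero-free strip: bounds uniform in `n` and in the alias, holomorphy, side covariance -/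

section StripBounds

variable (n : ℕ) [NeZero n]

/-- on `Strip d κ`, `0 ≤ κ ≤ κ_N(d)`: `‖𝒩‖ ≥ c_N(d) = (4/π²)^d/2 > 0`, every `n ≥ 1`. [folklore] -/
theorem cN_le_norm_Ncal {κ : ℝ} (hκ0 : 0 ≤ κ) (hκ : κ ≤ kappaN d) {p : Fin d → ℂ} (hp : p ∈ Strip d κ) :
    cN163 d ≤ ‖Ncal n p‖ := by
  unfold cN163
  exact Ncal_lower n hκ0 hκ p hp

/-- on the strip `𝒩 ≠ 0`. [folklore] -/
theorem Ncal_ne_zero_strip {κ : ℝ} (hκ0 : 0 ≤ κ) (hκ : κ ≤ kappaN d) {p : Fin d → ℂ} (hp : p ∈ Strip d κ) :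
    Ncal n p ≠ 0 := by
  intro h
  have := cN_le_norm_Ncal n hκ0 hκ hp
  rw [h, norm_zero] at this
  linarith [cN163_pos d]

/-- strip points are fat points (`κ ≤ κ_N ≤ r(d)`). [folklore] -/
theorem mem_Fat_of_strip {κ : ℝ} (hκ : κ ≤ kappaN d) {p : Fin d → ℂ} (hp : p ∈ Strip d κ) : p ∈ Fat d (rOf d) :=
  strip_subset_fat (rOf_pos d).le (hκ.trans (kappaN_le_rOf d)) hp

/-- the coefficient `c_H(d) = C_R(d,0)(8d+1)/c_N(d)` of the decaying bound of `h′_l`. [folklore] -/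
def cHP (d : ℕ) : ℝ := CR d 0 * (8 * d + 1) / cN163 d

/-- `0 ≤ c_H(d)`. [folklore] -/
theorem cHP_nonneg (d : ℕ) : 0 ≤ cHP d := by
  unfold cHP
  have := CR_nonneg d (le_refl (0 : ℝ)); have := cN163_pos d
  positivity

/-- **PRODUCT-DECAYING BOUND**: `‖h′_l(p′)‖ ≤ c_H(d)·Π_ν (12/ω_n(l_ν))·ω_n(l_ν)^{−2/d}` on the zero-free strip, every
`l` and every `n ≥ 1` (one `ρ_l` by its product-form quadratic gain, the other by `8d+1`). [folklore] -/
theorem norm_hP_le_decay (hd : 0 < d) {κ : ℝ} (hκ0 : 0 ≤ κ) (hκ : κ ≤ kappaN d) {p : Fin d → ℂ}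
    (hp : p ∈ Strip d κ) (k : Fin d → Fin n) :
    ‖hP n k p‖ ≤ cHP d * ∏ ν, (12 / omega n (k ν) * omega n (k ν) ^ (-(2 : ℝ) / d)) := by
  have hr := rOf_le d
  have hdr := d_mul_rOf_sq_le d
  have hq : p ∈ Fat d (rOf d) := mem_Fat_of_strip hκ hp
  have hN := cN_le_norm_Ncal n hκ0 hκ hp
  have hCR := CR_nonneg d (le_refl (0 : ℝ))
  have hdd : (0 : ℝ) ≤ d := Nat.cast_nonneg d
  have hA0 : 0 ≤ ∏ ν, 12 / omega n (k ν) :=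
    Finset.prod_nonneg (fun ν _ => div_nonneg (by norm_num) (omega_pos n (k ν) (k ν).isLt).le)
  have hB0 : 0 ≤ ∏ ν, omega n (k ν) ^ (-(2 : ℝ) / d) :=
    Finset.prod_nonneg (fun ν _ => Real.rpow_nonneg (omega_pos n (k ν) (k ν).isLt).le _)
  have h1 := norm_uCbar_le_prod n hr hq k
  have h2 := norm_rho_le_prod n hd hr hdr hq k
  have h3 := norm_rho_le n hr hdr hq k
  unfold hP
  calc ‖uCbar n k p * rho n k p ^ 2 / Ncal n p‖
      ≤ (∏ ν, 12 / omega n (k ν)) * ((CR d 0 * ∏ ν, omega n (k ν) ^ (-(2 : ℝ) / d)) * (8 * d + 1)) / cN163 d := by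
        refine norm_div_le_of ?_ (cN163_pos d) hN
        rw [norm_mul, pow_two, norm_mul]
        exact mul_le_mul h1 (mul_le_mul h2 h3 (norm_nonneg _) (by positivity)) (by positivity) hA0
    _ = cHP d * ((∏ ν, 12 / omega n (k ν)) * ∏ ν, omega n (k ν) ^ (-(2 : ℝ) / d)) := by
        unfold cHP; ring
    _ = cHP d * ∏ ν, (12 / omega n (k ν) * omega n (k ν) ^ (-(2 : ℝ) / d)) := by
        rw [Finset.prod_mul_distrib]

/-- the `n`-uniform alias-sum bound `S_H(d) = c_H(d)·(24ζ_d)^d`. [folklore] -/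
def SHP (d : ℕ) : ℝ := cHP d * (24 * zetaC d) ^ d

/-- `0 ≤ S_H(d)`. [folklore] -/
theorem SHP_nonneg (d : ℕ) : 0 ≤ SHP d := by
  unfold SHP; have := cHP_nonneg d; have := zetaC_nonneg d; positivity

/-- **THE `n`-UNIFORM ALIAS SUM** `Σ_l ‖h′_l(p′)‖ ≤ S_H(d)` on the zero-free strip (`B5Hk163Alias.sum_prod_decay_le`).
[folklore] -/
theorem sum_norm_hP_le (hd : 0 < d) {κ : ℝ} (hκ0 : 0 ≤ κ) (hκ : κ ≤ kappaN d) {p : Fin d → ℂ}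
    (hp : p ∈ Strip d κ) : ∑ k : Fin d → Fin n, ‖hP n k p‖ ≤ SHP d := by
  have hc := cHP_nonneg d
  calc ∑ k : Fin d → Fin n, ‖hP n k p‖
      ≤ ∑ k : Fin d → Fin n, cHP d * ∏ ν, (12 / omega n (k ν) * omega n (k ν) ^ (-(2 : ℝ) / d)) :=
        Finset.sum_le_sum (fun k _ => norm_hP_le_decay n hd hκ0 hκ hp k)
    _ = cHP d * ∑ k : Fin d → Fin n, ∏ ν, (12 / omega n (k ν) * omega n (k ν) ^ (-(2 : ℝ) / d)) := by
        rw [Finset.mul_sum]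
    _ ≤ cHP d * (24 * zetaC d) ^ d := mul_le_mul_of_nonneg_left (sum_prod_decay_le n hd) hc

/-- «H′_j is a bounded operator» at symbol level: `Σ_l ‖h′_l(p′)‖² ≤ S_H(d)²` on the zero-free strip (in particular on
the Brillouin zone), every `n ≥ 1` — the symbol of `H′*H′` is bounded by a `d`-only constant. [cite: Balaban1984PropagatorsII, p.241] [folklore] -/
theorem sum_normSq_hP_le (hd : 0 < d) {κ : ℝ} (hκ0 : 0 ≤ κ) (hκ : κ ≤ kappaN d) {p : Fin d → ℂ}
    (hp : p ∈ Strip d κ) : ∑ k : Fin d → Fin n, ‖hP n k p‖ ^ 2 ≤ SHP d ^ 2 := by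
  have hS := sum_norm_hP_le n hd hκ0 hκ hp
  have hS0 : 0 ≤ ∑ k : Fin d → Fin n, ‖hP n k p‖ := Finset.sum_nonneg (fun k _ => norm_nonneg _)
  have hk : ∀ k : Fin d → Fin n, ‖hP n k p‖ ≤ SHP d := fun k =>
    (Finset.single_le_sum (fun k _ => norm_nonneg (hP n k p)) (Finset.mem_univ k)).trans hS
  calc ∑ k : Fin d → Fin n, ‖hP n k p‖ ^ 2 ≤ ∑ k : Fin d → Fin n, ‖hP n k p‖ * SHP d := by
        refine Finset.sum_le_sum (fun k _ => ?_)
        rw [pow_two]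
        exact mul_le_mul_of_nonneg_left (hk k) (norm_nonneg _)
    _ = (∑ k : Fin d → Fin n, ‖hP n k p‖) * SHP d := by rw [Finset.sum_mul]
    _ ≤ SHP d * SHP d := mul_le_mul_of_nonneg_right hS (SHP_nonneg d)
    _ = SHP d ^ 2 := by ring

/-- real momenta are strip points (`κ = 0`). [folklore] -/
theorem ofRealVec_mem_Strip0 (s : Fin d → ℝ) (hs : ∀ μ, |s μ| ≤ Real.pi) : ofRealVec s ∈ Strip d 0 :=
  fun μ => ⟨by simpa [ofRealVec] using hs μ, by simp [ofRealVec]⟩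

/-- «H′_j is a bounded operator», real-momentum form: `Σ_l |h′_l(s)|² ≤ S_H(d)²` for every `s ∈ [−π,π]^d`, every
`n ≥ 1` — by Plancherel on `T_ξ` (alias components are orthogonal) this is `‖H′_j‖ ≤ S_H(d)`, a `d`-only bound.
[cite: Balaban1984PropagatorsII, p.241] [folklore] -/
theorem sum_normSq_hP_le_real (hd : 0 < d) (s : Fin d → ℝ) (hs : ∀ μ, |s μ| ≤ Real.pi) :
    ∑ k : Fin d → Fin n, ‖hP n k (ofRealVec s)‖ ^ 2 ≤ SHP d ^ 2 :=
  sum_normSq_hP_le n hd le_rfl (kappaN_pos d).le (ofRealVec_mem_Strip0 s hs)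

/-- the `d`-only bound `M_Δ′(d) = (16d)²/c_N(d)` of `Δ′` on the strip. [folklore] -/
def MdP (d : ℕ) : ℝ := (16 * d) ^ 2 / cN163 d

/-- `0 ≤ M_Δ′(d)`. [folklore] -/
theorem MdP_nonneg (d : ℕ) : 0 ≤ MdP d := by
  unfold MdP; have := cN163_pos d; positivity

/-- `‖Δ′(p′)‖ ≤ M_Δ′(d)` on the zero-free strip, every `n ≥ 1`. [folklore] -/
theorem norm_dP_le {κ : ℝ} (hκ0 : 0 ≤ κ) (hκ : κ ≤ kappaN d) {p : Fin d → ℂ} (hp : p ∈ Strip d κ) :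
    ‖dP n p‖ ≤ MdP d := by
  have hq : p ∈ Fat d (rOf d) := mem_Fat_of_strip hκ hp
  have hD := norm_DeltaXi0_le n (rOf_le d) hq
  have hD2 : ‖DeltaXi n 0 p ^ 2‖ ≤ (16 * d) ^ 2 := by
    rw [norm_pow]; exact pow_le_pow_left₀ (norm_nonneg _) hD 2
  unfold dP MdP
  exact norm_div_le_of hD2 (cN163_pos d) (cN_le_norm_Ncal n hκ0 hκ hp)

/-- `h′_l` is holomorphic at every point of the zero-free strip. [folklore] -/
theorem differentiableAt_hP {κ : ℝ} (hκ0 : 0 ≤ κ) (hκ : κ ≤ kappaN d) {p : Fin d → ℂ} (hp : p ∈ Strip d κ)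
    (k : Fin d → Fin n) : DifferentiableAt ℂ (fun q : Fin d → ℂ => hP n k q) p := by
  have hq : p ∈ Fat d (rOf d) := mem_Fat_of_strip hκ hp
  unfold hP
  exact dAt_div (((differentiable_uCbar n k) p).mul ((differentiableAt_rho n (rOf_le d) (d_mul_rOf_sq_le d) hq k).pow 2))
    (differentiableAt_Ncal n (rOf_le d) (d_mul_rOf_sq_le d) hq) (Ncal_ne_zero_strip n hκ0 hκ hp)

/-- `Δ′` is holomorphic at every point of the zero-free strip. [folklore] -/
theorem differentiableAt_dP {κ : ℝ} (hκ0 : 0 ≤ κ) (hκ : κ ≤ kappaN d) {p : Fin d → ℂ} (hp : p ∈ Strip d κ) :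
    DifferentiableAt ℂ (fun q : Fin d → ℂ => dP n q) p := by
  have hq : p ∈ Fat d (rOf d) := mem_Fat_of_strip hκ hp
  unfold dP
  exact dAt_div ((differentiableAt_DeltaXi n 0 p).pow 2)
    (differentiableAt_Ncal n (rOf_le d) (d_mul_rOf_sq_le d) hq) (Ncal_ne_zero_strip n hκ0 hκ hp)

/-- **ALIAS RE-INDEXING COVARIANCE OF `h′_l` ACROSS THE STRIP SIDES**: for `p′ ∈ Strip d κ` with `Re p′_ν = −π`,
`h′_l(p′ + 2πe_ν) = h′_{σ_ν l}(p′)` — the family is PERMUTED (`ρ_l` and `𝒩` each pick up the factor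
`Δ(p′+2πe_ν)/Δ(p′)` to the powers `1` and `2`, which cancel in `ρ_l²/𝒩`). [folklore] -/
theorem hP_tr {κ : ℝ} (hκ0 : 0 ≤ κ) (hκ : κ ≤ kappaN d) {p : Fin d → ℂ} (hp : p ∈ Strip d κ)
    (ν : Fin d) (hre : (p ν).re = -Real.pi) (k : Fin d → Fin n) :
    hP n k (tr p ν) = hP n (sigma n ν k) p := by
  obtain ⟨hκ1, hdκ⟩ := kappa_small hκ0 (hκ.trans (kappaN_le_rOf d))
  obtain ⟨hz, hz', h0, h1⟩ := edge_conditions n hκ1 hdκ hp ν hre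
  have hpt : tr p ν ∈ Strip d κ := tr_mem_Strip hp ν hre
  have hNp := Ncal_ne_zero_strip n hκ0 hκ hp
  have hNt := Ncal_ne_zero_strip n hκ0 hκ hpt
  have Hρ : rho n k (tr p ν) = rho n (sigma n ν k) p * DeltaXi n 0 (tr p ν) / DeltaXi n 0 p :=
    eq_div_of_mul_eq h0 (rho_tr_mul n k ν h0 h1)
  have HN : Ncal n (tr p ν) = DeltaXi n 0 (tr p ν) ^ 2 * Ncal n p / DeltaXi n 0 p ^ 2 :=
    eq_div_of_mul_eq (pow_ne_zero 2 h0) (Ncal_tr n p ν hz hz' h0 h1)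
  unfold hP
  rw [uCbar_tr, Hρ, HN]
  field_simp

/-- **SIDE PERIODICITY OF `Δ′`**: `Δ′(p′ + 2πe_ν) = Δ′(p′)` at the side points `Re p′_ν = −π` of the strip. [folklore] -/
theorem dP_tr {κ : ℝ} (hκ0 : 0 ≤ κ) (hκ : κ ≤ kappaN d) {p : Fin d → ℂ} (hp : p ∈ Strip d κ)
    (ν : Fin d) (hre : (p ν).re = -Real.pi) : dP n (tr p ν) = dP n p := by
  obtain ⟨hκ1, hdκ⟩ := kappa_small hκ0 (hκ.trans (kappaN_le_rOf d))
  obtain ⟨hz, hz', h0, h1⟩ := edge_conditions n hκ1 hdκ hp ν hre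
  have hNp := Ncal_ne_zero_strip n hκ0 hκ hp
  have HN : Ncal n (tr p ν) = DeltaXi n 0 (tr p ν) ^ 2 * Ncal n p / DeltaXi n 0 p ^ 2 :=
    eq_div_of_mul_eq (pow_ne_zero 2 h0) (Ncal_tr n p ν hz hz' h0 h1)
  unfold dP
  rw [HN]
  field_simp

end StripBounds

/-! ## §3. Fine-offset multipliers, strip regularity (dimension `d+1`) and the kernel decay corollaries -/

section FineOffset

variable (n : ℕ) [NeZero n]

/-- THE COARSE MULTIPLIER OF FINE OFFSET `a` of `H′_j`: `G′_a(p′) = Σ_{l ∈ 2π{0,…,n−1}^d} e^{i(p′+l)·ηa} h′_l(p′)` — its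
`ℤ^d`-Fourier kernel at `y′ − y` is the kernel of `H′_j` from the unit point `y` to the fine point `y′ + ηa`
(`B5Hk163Decay.exp_fine_phase_split`). [cite: Balaban1984PropagatorsII, (2.101) p.241] [folklore] -/
def GH (a : Fin d → Fin n) (p : Fin d → ℂ) : ℂ :=
  ∑ k : Fin d → Fin n, phase163 n k a p * hP n k p

/-- SIDE PERIODICITY `G′_a(p′ + 2πe_ν) = G′_a(p′)` at `Re p′_ν = −π` (the alias family is permuted by `σ_ν`, the phase
is `σ_ν`-covariant). [folklore] -/
theorem GH_tr {κ : ℝ} (hκ0 : 0 ≤ κ) (hκ : κ ≤ kappaN d) {p : Fin d → ℂ} (hp : p ∈ Strip d κ) (ν : Fin d)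
    (hre : (p ν).re = -Real.pi) (a : Fin d → Fin n) : GH n a (tr p ν) = GH n a p := by
  unfold GH
  have h : ∀ k : Fin d → Fin n, phase163 n k a (tr p ν) * hP n k (tr p ν) =
      phase163 n (sigma n ν k) a p * hP n (sigma n ν k) p := fun k => by
    rw [phase163_tr, hP_tr n hκ0 hκ hp ν hre k]
  simp_rw [h]
  exact Equiv.sum_comp (sigmaEquiv n ν) (fun k => phase163 n k a p * hP n k p)

/-- THE STRIP BOUND `‖G′_a(p′)‖ ≤ (e^κ)^d · S_H(d)`, uniformly in `n` and `a`. [folklore] -/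
theorem norm_GH_le (hd : 0 < d) {κ : ℝ} (hκ0 : 0 ≤ κ) (hκ : κ ≤ kappaN d) {p : Fin d → ℂ} (hp : p ∈ Strip d κ)
    (a : Fin d → Fin n) : ‖GH n a p‖ ≤ Real.exp κ ^ d * SHP d := by
  unfold GH
  calc ‖∑ k : Fin d → Fin n, phase163 n k a p * hP n k p‖
      ≤ ∑ k : Fin d → Fin n, ‖phase163 n k a p * hP n k p‖ := norm_sum_le _ _
    _ ≤ ∑ k : Fin d → Fin n, Real.exp κ ^ d * ‖hP n k p‖ := by
        refine Finset.sum_le_sum (fun k _ => ?_)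
        rw [norm_mul]
        exact mul_le_mul_of_nonneg_right (norm_phase163_le n hp k a) (norm_nonneg _)
    _ = Real.exp κ ^ d * ∑ k : Fin d → Fin n, ‖hP n k p‖ := by rw [Finset.mul_sum]
    _ ≤ Real.exp κ ^ d * SHP d := mul_le_mul_of_nonneg_left (sum_norm_hP_le n hd hκ0 hκ hp) (by positivity)

/-- HOLOMORPHY of `G′_a` at every point of the zero-free strip. [folklore] -/
theorem differentiableAt_GH {κ : ℝ} (hκ0 : 0 ≤ κ) (hκ : κ ≤ kappaN d) {p : Fin d → ℂ} (hp : p ∈ Strip d κ)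
    (a : Fin d → Fin n) : DifferentiableAt ℂ (fun q : Fin d → ℂ => GH n a q) p := by
  unfold GH
  exact DifferentiableAt.fun_sum (fun k _ =>
    ((differentiable_phase163 n k a) p).mul (differentiableAt_hP n hκ0 hκ hp k))

end FineOffset

section Regular

/-- the explicit `d`-only strip bound `(e¹)^d · S_H(d)` of the fine-offset multipliers (uses `κ ≤ κ_N ≤ 1`). [folklore] -/
def MGH (d : ℕ) : ℝ := Real.exp 1 ^ d * SHP d

/-- `0 ≤ MGH d`. [folklore] -/
theorem MGH_nonneg (d : ℕ) : 0 ≤ MGH d := by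
  unfold MGH; have := SHP_nonneg d; positivity

/-- **STRIP REGULARITY OF THE FINE-OFFSET MULTIPLIERS OF `H′_j`** on `ℂ^{d+1}`: for EVERY `n ≥ 1`, fine offset `a` and
`0 ≤ κ ≤ κ_N(d+1)`, `GH n a` is continuous on the closed strip, holomorphic in every coordinate slice, takes equal values
on the vertical sides, and is bounded by `MGH (d+1)` — constants depending on the dimension only. [folklore] -/
theorem stripRegular_GH (n : ℕ) [NeZero n] {κ : ℝ} (hκ0 : 0 ≤ κ) (hκ : κ ≤ kappaN (d + 1))
    (a : Fin (d + 1) → Fin n) :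
    StripRegular (d := d) (fun p : Fin (d + 1) → ℂ => GH n a p) κ (MGH (d + 1)) := by
  have hκ1 : κ ≤ 1 := (kappa_small hκ0 (hκ.trans (kappaN_le_rOf _))).1
  have hdiffAt : ∀ p ∈ Strip (d + 1) κ, DifferentiableAt ℂ (fun q : Fin (d + 1) → ℂ => GH n a q) p :=
    fun p hp => differentiableAt_GH n hκ0 hκ hp a
  refine ⟨?_, ?_, ?_, ?_⟩
  · exact fun p hp => (hdiffAt p hp).continuousAt.continuousWithinAt
  · intro i q hq z hz
    have hP : i.insertNth z (ofRealVec q) ∈ Strip (d + 1) κ :=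
      insertNth_mem_Strip hκ0 i hq (openRect_subset_closedRect κ hz)
    exact ((hdiffAt _ hP).comp z (differentiableAt_insertNth i _ z)).differentiableWithinAt
  · intro i q hq y hy
    obtain ⟨hP, hre⟩ := insertNth_left_mem hκ0 i hq hy
    show GH n a _ = GH n a _
    rw [← tr_insertNth_left]
    exact (GH_tr n hκ0 hκ hP i hre a).symm
  · intro p hp
    refine (norm_GH_le n (Nat.succ_pos d) hκ0 hκ hp a).trans ?_
    unfold MGH
    have hM := SHP_nonneg (d + 1)
    have he : Real.exp κ ^ (d + 1) ≤ Real.exp 1 ^ (d + 1) :=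
      pow_le_pow_left₀ (Real.exp_pos κ).le (Real.exp_le_exp.mpr hκ1) _
    exact mul_le_mul_of_nonneg_right he hM

/-- **STRIP REGULARITY OF `Δ′_j`** (2.108) on `ℂ^{d+1}`: every `n ≥ 1`, `0 ≤ κ ≤ κ_N(d+1)`, bound `M_Δ′(d+1)`. [folklore] -/
theorem stripRegular_dP (n : ℕ) [NeZero n] {κ : ℝ} (hκ0 : 0 ≤ κ) (hκ : κ ≤ kappaN (d + 1)) :
    StripRegular (d := d) (fun p : Fin (d + 1) → ℂ => dP n p) κ (MdP (d + 1)) := by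
  have hdiffAt : ∀ p ∈ Strip (d + 1) κ, DifferentiableAt ℂ (fun q : Fin (d + 1) → ℂ => dP n q) p :=
    fun p hp => differentiableAt_dP n hκ0 hκ hp
  refine ⟨?_, ?_, ?_, ?_⟩
  · exact fun p hp => (hdiffAt p hp).continuousAt.continuousWithinAt
  · intro i q hq z hz
    have hP : i.insertNth z (ofRealVec q) ∈ Strip (d + 1) κ :=
      insertNth_mem_Strip hκ0 i hq (openRect_subset_closedRect κ hz)
    exact ((hdiffAt _ hP).comp z (differentiableAt_insertNth i _ z)).differentiableWithinAt
  · intro i q hq y hy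
    obtain ⟨hP, hre⟩ := insertNth_left_mem hκ0 i hq hy
    show dP n _ = dP n _
    rw [← tr_insertNth_left]
    exact (dP_tr n hκ0 hκ hP i hre).symm
  · exact fun p hp => norm_dP_le n hκ0 hκ hp

/-- **EXPONENTIAL DECAY OF THE INFINITE-LATTICE KERNELS OF `H′_j`** (`B4ContourShift.latticeKernel_decay` by name):
`‖K′_a(x)‖ ≤ MGH(d+1) · e^{−κ_N(d+1)·|x|_∞}` for every `x ∈ ℤ^{d+1}`, `n ≥ 1`, fine offset `a` — «a bounded operator with
an exponential decay, the bound and decay rate depending on d only». [cite: Balaban1984PropagatorsII, p.241] [folklore] -/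
theorem latticeKernel_GH_decay (n : ℕ) [NeZero n] (a : Fin (d + 1) → Fin n) (x : Fin (d + 1) → ℤ) :
    ‖latticeKernel (fun p : Fin (d + 1) → ℂ => GH n a p) x‖ ≤
      MGH (d + 1) * Real.exp (-(kappaN (d + 1) * supNorm x)) :=
  latticeKernel_decay (stripRegular_GH n (kappaN_pos _).le le_rfl a) (kappaN_pos _).le x

/-- **EXPONENTIAL DECAY OF THE TORUS KERNELS OF `H′_j`** (`B4TorusKernel.MultiPeriod.torusKernel_descend_decay_torusMetric`
by name): for every period vector `N` (all `N_i ≥ 1`), `n ≥ 1`, `a`, `x`: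
`‖K′_{a,N}(x)‖ ≤ MGH(d+1) · periodConst(κ_N(d+1), d) · e^{−(κ_N(d+1)/(d+1))·|x|_{T,∞}}`. [cite: Balaban1984PropagatorsII, p.241] [folklore] -/
theorem torusKernel_GH_decay (n : ℕ) [NeZero n] (a : Fin (d + 1) → Fin n) {N : Fin (d + 1) → ℕ}
    (hN : ∀ i, 1 ≤ N i) (x : Fin (d + 1) → ℤ) :
    ‖torusKernel (descendC (fun p : Fin (d + 1) → ℂ => GH n a p)
        (stripRegular_GH n (kappaN_pos _).le le_rfl a) (kappaN_pos _).le) N x‖ ≤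
      MGH (d + 1) * periodConst (kappaN (d + 1)) d *
        Real.exp (-(kappaN (d + 1) / (d + 1) * torusSupNorm N x)) :=
  torusKernel_descend_decay_torusMetric _ (kappaN_pos _) hN x

/-- **«AN EXPONENTIAL DECAY OF Δ′_j(y − y′)»**, infinite unit lattice `ℤ^{d+1}` (`B4ContourShift.latticeKernel_decay` by
name): `‖Δ′(x)‖ ≤ M_Δ′(d+1) · e^{−κ_N(d+1)·|x|_∞}`, every `n ≥ 1`. [cite: Balaban1984PropagatorsII, p.242 (sentence after (2.108))] [folklore] -/
theorem latticeKernel_dP_decay (n : ℕ) [NeZero n] (x : Fin (d + 1) → ℤ) :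
    ‖latticeKernel (fun p : Fin (d + 1) → ℂ => dP n p) x‖ ≤
      MdP (d + 1) * Real.exp (-(kappaN (d + 1) * supNorm x)) :=
  latticeKernel_decay (stripRegular_dP n (kappaN_pos _).le le_rfl) (kappaN_pos _).le x

/-- **«AN EXPONENTIAL DECAY OF Δ′_j(y − y′)»** on every unit torus `Π_i ℤ/N_i` (all `N_i ≥ 1`), every `n ≥ 1`:
`‖Δ′_N(x)‖ ≤ M_Δ′(d+1) · periodConst(κ_N(d+1), d) · e^{−(κ_N(d+1)/(d+1))·|x|_{T,∞}}`. [cite: Balaban1984PropagatorsII, p.242] [folklore] -/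
theorem torusKernel_dP_decay (n : ℕ) [NeZero n] {N : Fin (d + 1) → ℕ} (hN : ∀ i, 1 ≤ N i) (x : Fin (d + 1) → ℤ) :
    ‖torusKernel (descendC (fun p : Fin (d + 1) → ℂ => dP n p)
        (stripRegular_dP n (kappaN_pos _).le le_rfl) (kappaN_pos _).le) N x‖ ≤
      MdP (d + 1) * periodConst (kappaN (d + 1)) d *
        Real.exp (-(kappaN (d + 1) / (d + 1) * torusSupNorm N x)) :=
  torusKernel_descend_decay_torusMetric _ (kappaN_pos _) hN x

/-- the sup-distance of `ℤ^{d+1}` is dominated by the sup norm of the difference (they are equal; `≤` is what is used).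
[folklore] -/
theorem dist_le_supNorm (y y' : Fin (d + 1) → ℤ) : dist y y' ≤ supNorm (y - y') := by
  refine (dist_pi_le_iff (supNorm_nonneg _)).mpr (fun i => ?_)
  rw [Int.dist_eq]
  have h := abs_le_supNorm (y - y') i
  have hc : (((|(y - y') i| : ℤ) : ℝ)) = |((y i : ℝ)) - (y' i : ℝ)| := by
    push_cast [Pi.sub_apply]
    ring_nf
  linarith [hc ▸ h]

/-- **THE ENTRYWISE SHAPE** of the decay of `Δ′_j` on `ℤ^{d+1}` — literally `B6Elimination.KernelDecay Λ Δ (M_Δ′(d+1)) (κ_N(d+1))`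
for the matrix `Δ p q := Re K(p − q)` of any region `Λ ⊂ ℤ^{d+1}` (that hypothesis shape reads
`∀ p q, |Δ p q| ≤ c₀·e^{−δ₀·dist p q}`): for all `y, y′`, `|Re Δ′(y − y′)| ≤ M_Δ′(d+1)·e^{−κ_N(d+1)·dist(y,y′)}`, every
`n ≥ 1`, constants `d`-only. [cite: Balaban1984PropagatorsII, p.242] [folklore] -/
theorem kernelDecay_dP (n : ℕ) [NeZero n] (y y' : Fin (d + 1) → ℤ) :
    |(latticeKernel (fun p : Fin (d + 1) → ℂ => dP n p) (y - y')).re| ≤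
      MdP (d + 1) * Real.exp (-(kappaN (d + 1) * dist y y')) := by
  refine (Complex.abs_re_le_norm _).trans ((latticeKernel_dP_decay n (y - y')).trans ?_)
  refine mul_le_mul_of_nonneg_left (Real.exp_le_exp.mpr ?_) (MdP_nonneg _)
  have := dist_le_supNorm y y'
  have hκ := (kappaN_pos (d + 1)).le
  nlinarith

/-- the ENTRYWISE form for `H′_j`: the kernel from the unit point `y` to the fine point `y′ + ηa` is bounded by
`MGH(d+1)·e^{−κ_N(d+1)·dist(y,y′)}`, every `n ≥ 1`, every `a` (the shape consumed at step (S3) of `B6Elimination`).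
[cite: Balaban1984PropagatorsII, p.241] [folklore] -/
theorem kernelDecay_GH (n : ℕ) [NeZero n] (a : Fin (d + 1) → Fin n) (y y' : Fin (d + 1) → ℤ) :
    ‖latticeKernel (fun p : Fin (d + 1) → ℂ => GH n a p) (y' - y)‖ ≤
      MGH (d + 1) * Real.exp (-(kappaN (d + 1) * dist y y')) := by
  refine (latticeKernel_GH_decay n a (y' - y)).trans ?_
  refine mul_le_mul_of_nonneg_left (Real.exp_le_exp.mpr ?_) (MGH_nonneg _)
  have := dist_le_supNorm y' y
  rw [dist_comm] at this
  have hκ := (kappaN_pos (d + 1)).le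
  nlinarith

end Regular

/-! ## §4. The real-momentum two-sided bound (2.109) at symbol level -/

section RealBounds

/-- the REAL (2.108) regrouped: `Δ′(s) = Δ(s)²/𝒩(s)`. [folklore] -/
def dPr (n : ℕ) [NeZero n] (s : Fin d → ℝ) : ℝ := DeltaXir n 0 s ^ 2 / Ncalr n s

/-- on real momenta the continued `Δ′` is the real `Δ′`. [folklore] -/
theorem dP_ofReal (n : ℕ) [NeZero n] (s : Fin d → ℝ) : dP n (ofRealVec s) = ((dPr n s : ℝ) : ℂ) := by
  unfold dP dPr
  rw [DeltaXi_ofReal, Ncal_ofReal]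
  push_cast
  rfl

/-- the constant `c₁(d) = (π²/4)²/(4/π²)^d` of (2.109). [folklore] -/
def c1_2109 (d : ℕ) : ℝ := (Real.pi ^ 2 / 4) ^ 2 / (4 / Real.pi ^ 2) ^ d

/-- the constant `c₀(d) = 1/N₊(d)` of (2.109) (`N₊ = B5Strip145Leaves.boundN`). [folklore] -/
def c0_2109 (d : ℕ) : ℝ := 1 / boundN d

/-- the constant `γ₁(d) = c₁(d)·(4d)²` of (2.109). [folklore] -/
def gamma1_2109 (d : ℕ) : ℝ := c1_2109 d * (4 * d) ^ 2

/-- `0 < c₁(d)`. [folklore] -/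
theorem c1_2109_pos (d : ℕ) : 0 < c1_2109 d := by unfold c1_2109; positivity

/-- `0 < c₀(d)`. [folklore] -/
theorem c0_2109_pos (d : ℕ) : 0 < c0_2109 d := by
  unfold c0_2109; have := boundN_pos d; positivity

/-- `𝒩(s) ≤ N₊(d)` on the Brillouin zone (the sup leaf of the b05 cell, at real points). [folklore] -/
theorem Ncalr_le (n : ℕ) [NeZero n] (s : Fin d → ℝ) (hs : ∀ μ, |s μ| ≤ Real.pi) : Ncalr n s ≤ boundN d := by
  have hq : ofRealVec s ∈ Fat d (rOf d) :=
    strip_subset_fat (rOf_pos d).le (rOf_pos d).le (ofRealVec_mem_Strip0 s hs)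
  have h := norm_Ncal_le n (rOf_le d) (d_mul_rOf_sq_le d) hq
  rw [Ncal_ofReal, Complex.norm_real] at h
  exact (le_abs_self _).trans h

/-- **(2.109) AT SYMBOL LEVEL**: on the Brillouin zone `|s_μ| ≤ π`, for every `n ≥ 1`,
`c₀(d)·Δ₀(s)² ≤ Δ′(s) ≤ c₁(d)·Δ₀(s)² ≤ γ₁(d)` — the multipliers of «c₀‖Δ₀ω‖² ≦ ⟨ω,Δ′_jω⟩ ≦ c₁‖Δ₀ω‖² ≦ γ₁‖ω‖²» with
`d`-only constants (inputs: `B5Prop11Leaves.Delta1r_le_DeltaXir` / `DeltaXir_le_Delta1r` / `Delta1r_le`,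
`B5Strip145.Ncalr_ge`, `B5Strip145Leaves.norm_Ncal_le`).
[cite: Balaban1984PropagatorsII, (2.109) p.242] [folklore] -/
theorem bound_2109 (n : ℕ) [NeZero n] (s : Fin d → ℝ) (hs : ∀ μ, |s μ| ≤ Real.pi) :
    c0_2109 d * Delta1r 0 s ^ 2 ≤ dPr n s ∧ dPr n s ≤ c1_2109 d * Delta1r 0 s ^ 2 ∧
      c1_2109 d * Delta1r 0 s ^ 2 ≤ gamma1_2109 d := by
  have hn : 1 ≤ n := Nat.one_le_iff_ne_zero.mpr (NeZero.ne n)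
  have hpi := Real.pi_pos
  have hNlo := Ncalr_ge n hn s hs
  have hNhi := Ncalr_le n s hs
  have hc : (0 : ℝ) < (4 / Real.pi ^ 2) ^ d := by positivity
  have hNpos : 0 < Ncalr n s := lt_of_lt_of_le hc hNlo
  have hB := boundN_pos d
  have hD0 := Delta1r_nonneg 0 le_rfl s
  have hX0 := DeltaXir_nonneg n 0 le_rfl s
  have hup := DeltaXir_le_Delta1r n s hs
  have hlo := Delta1r_le_DeltaXir n hn s
  have hD4 := Delta1r_le s
  refine ⟨?_, ?_, ?_⟩
  · -- lower: c₀ Δ₀² ≤ Δ²/𝒩 (uses the tree's `Δ₀ ≤ Δ`, `B5Prop11Leaves.Delta1r_le_DeltaXir`)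
    unfold dPr c0_2109
    rw [div_mul_eq_mul_div, one_mul, div_le_div_iff₀ hB hNpos]
    have h2 : Delta1r 0 s ^ 2 ≤ DeltaXir n 0 s ^ 2 := pow_le_pow_left₀ hD0 hlo 2
    calc Delta1r 0 s ^ 2 * Ncalr n s ≤ DeltaXir n 0 s ^ 2 * Ncalr n s :=
          mul_le_mul_of_nonneg_right h2 hNpos.le
      _ ≤ DeltaXir n 0 s ^ 2 * boundN d := mul_le_mul_of_nonneg_left hNhi (sq_nonneg _)
  · -- upper: Δ²/𝒩 ≤ c₁ Δ₀²
    unfold dPr c1_2109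
    rw [div_mul_eq_mul_div, div_le_div_iff₀ hNpos hc]
    have h2 : DeltaXir n 0 s ^ 2 ≤ (Real.pi ^ 2 / 4) ^ 2 * Delta1r 0 s ^ 2 := by
      rw [← mul_pow]; exact pow_le_pow_left₀ hX0 hup 2
    calc DeltaXir n 0 s ^ 2 * (4 / Real.pi ^ 2) ^ d ≤ (Real.pi ^ 2 / 4) ^ 2 * Delta1r 0 s ^ 2 * (4 / Real.pi ^ 2) ^ d :=
          mul_le_mul_of_nonneg_right h2 hc.le
      _ ≤ (Real.pi ^ 2 / 4) ^ 2 * Delta1r 0 s ^ 2 * Ncalr n s :=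
          mul_le_mul_of_nonneg_left hNlo (by positivity)
  · -- c₁ Δ₀² ≤ γ₁
    unfold gamma1_2109
    have h : Delta1r 0 s ^ 2 ≤ (4 * d) ^ 2 := pow_le_pow_left₀ hD0 hD4 2
    exact mul_le_mul_of_nonneg_left h (c1_2109_pos d).le

end RealBounds

end

end Literature.MathematicalPhysics.QuantumFieldTheory.Balaban1983to89.B6Hprime2101
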